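import Summits.ResolutionOfSingularities.ResolutionOfSingularities.Theorems.FrobeniusLadderFInjectiveMacaulayficationClauseOfMaximal
import Summits.ResolutionOfSingularities.ResolutionOfSingularities.Theorems.FrobeniusLadderFInjectiveMacaulayficationReesChartRing
import Summits.ResolutionOfSingularities.ResolutionOfSingularities.Theorems.FrobeniusLadderFInjectiveMacaulayficationOffExceptionalIso
import Summits.ResolutionOfSingularities.ResolutionOfSingularities.Theorems.FrobeniusLadderFInjectiveMacaulayficationOnExceptionalDeform
import Summits.ResolutionOfSingularities.ResolutionOfSingularities.Theorems.FrobeniusLadderFInjectiveMacaulayficationQuotLocalizationIso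
import Summits.ResolutionOfSingularities.ResolutionOfSingularities.Theorems.FrobeniusLadderFInjectiveMacaulayficationStalkChartIso
import HarnessLib

/-!
# The blow-up glue: chart clause ⇒ the crux's model for `Spec R` via `Bl_I` (crux `FInjectiveMacaulayfication`)

Support file for crux stmt-ResolutionOfSingularities-15315 (`FrobeniusLadder.FInjectiveMacaulayfication`,
line `Sketch`, lead seat c4, cycle 5): the lead's stub `stub_blowupFiModel`, ENGINE E6 of the line's toolbox —
the scheme-level glue that every engine for the open core `stub_fInjectivize` needs and no crux card supplies.
It turns the crux's conclusion for an affine input `X₁ = Spec R` into commutative algebra on the charts of the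
blowing up `Bl_I(Spec R) = affineBlowup I = Proj R[It]` (tree: `Literature/AlgebraicGeometry/Resolution/AffineBlowup.lean`,
proper `affineBlowup.isProper`, birational `affineBlowup.isBirational`):

* `chart_fiClause` — for a Noetherian domain `R` of characteristic `p`, `a ∈ I` non-zero, the chart ring
  `A = (R[It])_{(at)} = R[I/a]` satisfies the FULL stalk clause of the crux (domain; every system of parameters
  weakly regular; parameter ideals Frobenius closed) at every prime, provided `R_P` does at the primes `P ∌ a`
  and the exceptional-divisor chart `A ⧸ (a/1)` satisfies the Cohen–Macaulay + Frobenius-closed clause at its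
  maximal ideals. Assembly of wave 1: reduce to maximal `Q` (`ClauseOfMaximal.stub_clauseOfMaximal`, E5); off
  the exceptional divisor `A_Q ≅ R_{Q ∩ R}` (`OffExceptionalIso.stub_offExceptionalIso`, two localizations of
  `R[1/a]`, `isLocalization_reesChart`); on it, `A_Q/(a/1) ≅ (A/(a/1))_{Q/(a/1)}`
  (`QuotLocalizationIso.stub_quotLocalizationIso`) and deformation across the Cartier exceptional divisor
  (`OnExceptionalDeform.stub_onExceptionalDeform` = E1, Fedder 1983 Thm 3.4 (1); `a/1` is a non-zero-divisor,
  `reesChartBase_mem_nonZeroDivisors`); the chart ring is a Noetherian domain of characteristic `p`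
  (`ReesChartRing.stub_reesChartRing`).
* `stub_blowupFiModel` (registered form) — hence, with `I = (x₁, …, x_r) ≠ 0`: if `R_P` satisfies the full
  clause at every prime `P ⊉ I` and every exceptional chart `A_{xᵢ} ⧸ (xᵢ/1)` (`xᵢ ≠ 0`) satisfies the CM +
  Frobenius-closed clause at its maximal ideals, then `Spec R` admits the crux's model, namely
  `X' = affineBlowup I` (stalks = localizations of chart rings at the generators,
  `StalkChartIso.stub_stalkChartIso`).

This is the affine engine step of every blow-up line for the crux (Kawasaki-shape induction on the
non-F-injective locus with NON-parameter centres — parameter centres are excluded by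
`…ParameterCentreNoGo` —, weighted tangent cones via `I = I_N`, and the calibration `Bl_𝔪 E₈⁰` in
characteristic 5): what remains for such a line is pure local algebra on explicit chart rings.

References: The Stacks Project, Tags 0804 (affine blowup algebras), 02OS (isomorphism off the centre);
R. Fedder, Trans. AMS 278 (1983), Thm. 3.4 (1) (deformation of F-injectivity in the CM case). [folklore]
-/

-- single-problem summit: the doubled namespace component is forced
set_option linter.dupNamespace false

noncomputable section

namespace Summit.ResolutionOfSingularities.ResolutionOfSingularities.Theorems.FInjectiveMacaulayfication.BlowupFiModel

open AlgebraicGeometry CategoryTheory Literature.AlgebraicGeometry.Resolution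

variable (p : ℕ) [Fact p.Prime]

/-- The image of a maximal ideal `Q ⊇ ker f` under a surjection `f` is maximal and pulls back to `Q`.
[folklore] -/
theorem isMaximal_map_and_comap_map_of_surjective {A B : Type*} [CommRing A] [CommRing B] (f : A →+* B)
    (hf : Function.Surjective f) (Q : Ideal A) [hQ : Q.IsMaximal] (hker : RingHom.ker f ≤ Q) :
    (Q.map f).IsMaximal ∧ (Q.map f).comap f = Q := by
  have hcomap : (Q.map f).comap f = Q := by
    rw [Ideal.comap_map_of_surjective f hf, ← RingHom.ker_eq_comap_bot, sup_eq_left.mpr hker]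
  refine ⟨?_, hcomap⟩
  rcases Ideal.map_eq_top_or_isMaximal_of_surjective f hf hQ with htop | hmax
  · exfalso
    apply hQ.ne_top
    rw [← hcomap, htop, Ideal.comap_top]
  · exact hmax

/-- Off the exceptional divisor the local rings of the chart `A = (R[It])_{(at)}` are local rings of the
base: for a prime `Q ∌ a/1`, `A_Q ≅ R_{Q ∩ R}` (`A[1/(a/1)] = R[1/a]`, `isLocalization_reesChart`;
`OffExceptionalIso.stub_offExceptionalIso`). [cite: StacksProject, Tag 02OS] -/
theorem nonempty_ringEquiv_offExceptional {R : Type} [CommRing R] {I : Ideal R} (a : R) (ha : a ∈ I)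
    (Q : Ideal (HomogeneousLocalization.Away (reesGrading I) (reesT a ha))) [Q.IsPrime]
    (huQ : reesChartBase (I := I) a ha a ∉ Q) :
    Nonempty (Localization.AtPrime Q ≃+* Localization.AtPrime (Q.comap (reesChartBase (I := I) a ha))) := by
  letI : Algebra (HomogeneousLocalization.Away (reesGrading I) (reesT a ha)) (Localization.Away a) :=
    (reesChart a ha).toAlgebra
  have hlocA : IsLocalization.Away (reesChartBase (I := I) a ha a) (Localization.Away a) :=
    isLocalization_reesChart a ha
  have hcomp : (algebraMap (HomogeneousLocalization.Away (reesGrading I) (reesT a ha))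
      (Localization.Away a)).comp (reesChartBase (I := I) a ha) = algebraMap R (Localization.Away a) :=
    reesChart_comp_reesChartBase a ha
  exact OffExceptionalIso.stub_offExceptionalIso R
    (HomogeneousLocalization.Away (reesGrading I) (reesT a ha)) (Localization.Away a)
    (reesChartBase (I := I) a ha) a hcomp inferInstance hlocA Q huQ

/-- **The chart rings of `Bl_I(Spec R)` satisfy the full stalk clause at every prime** when `R_P` does off
`V(a)` and the exceptional chart `A ⧸ (a/1)` satisfies the Cohen–Macaulay + Frobenius-closed clause at its
maximal ideals (`A = (R[It])_{(at)}`, `a ∈ I` non-zero, `R` a Noetherian domain of characteristic `p`).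
Assembly of E5 (maximal ⇒ all primes), the off-exceptional iso `A_Q ≅ R_{Q ∩ R}`, and E1 deformation across
the Cartier exceptional divisor. [folklore] -/
theorem chart_fiClause {R : Type} [CommRing R] [IsDomain R] [IsNoetherianRing R] [CharP R p] {I : Ideal R}
    (a : R) (ha : a ∈ I) (ha0 : a ≠ 0)
    (hoff : ∀ (P : Ideal R) [P.IsPrime], a ∉ P →
      IsDomain (Localization.AtPrime P) ∧
      ∀ d : ℕ, ringKrullDim (Localization.AtPrime P) = d → ∀ s : Fin d → Localization.AtPrime P,
        (Ideal.span (Set.range s)).radical.IsMaximal →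
          RingTheory.Sequence.IsWeaklyRegular (Localization.AtPrime P) (List.ofFn s) ∧
          ∀ y : Localization.AtPrime P, (∃ e : ℕ, y ^ p ^ e ∈ Ideal.span
            ((fun z : Localization.AtPrime P => z ^ p ^ e) ''
              (Ideal.span (Set.range s) : Set (Localization.AtPrime P)))) → y ∈ Ideal.span (Set.range s))
    (hexc : ∀ (Q : Ideal (HomogeneousLocalization.Away (reesGrading I) (reesT a ha) ⧸
        Ideal.span {reesChartBase (I := I) a ha a})) [Q.IsMaximal],
      ∀ d : ℕ, ringKrullDim (Localization.AtPrime Q) = d → ∀ s : Fin d → Localization.AtPrime Q,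
        (Ideal.span (Set.range s)).radical.IsMaximal →
          RingTheory.Sequence.IsWeaklyRegular (Localization.AtPrime Q) (List.ofFn s) ∧
          ∀ y : Localization.AtPrime Q, (∃ e : ℕ, y ^ p ^ e ∈ Ideal.span
            ((fun z : Localization.AtPrime Q => z ^ p ^ e) ''
              (Ideal.span (Set.range s) : Set (Localization.AtPrime Q)))) → y ∈ Ideal.span (Set.range s))
    (q : Ideal (HomogeneousLocalization.Away (reesGrading I) (reesT a ha))) [q.IsPrime] :
    IsDomain (Localization.AtPrime q) ∧
      ∀ d : ℕ, ringKrullDim (Localization.AtPrime q) = d → ∀ s : Fin d → Localization.AtPrime q,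
        (Ideal.span (Set.range s)).radical.IsMaximal →
          RingTheory.Sequence.IsWeaklyRegular (Localization.AtPrime q) (List.ofFn s) ∧
          ∀ y : Localization.AtPrime q, (∃ e : ℕ, y ^ p ^ e ∈ Ideal.span
            ((fun z : Localization.AtPrime q => z ^ p ^ e) ''
              (Ideal.span (Set.range s) : Set (Localization.AtPrime q)))) → y ∈ Ideal.span (Set.range s) := by
  -- the chart ring `A = R[I/a]` is a Noetherian domain of characteristic `p`; `u = a/1 ≠ 0`
  obtain ⟨hnoeth, hdom, hchar⟩ := ReesChartRing.stub_reesChartRing p R I a ha ha0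
  have hu0 : reesChartBase (I := I) a ha a ≠ 0 :=
    nonZeroDivisors.ne_zero (reesChartBase_mem_nonZeroDivisors a ha)
  -- reduce to maximal ideals (E5)
  refine ClauseOfMaximal.stub_clauseOfMaximal p
    (HomogeneousLocalization.Away (reesGrading I) (reesT a ha)) ?_ q
  intro Q hQmax
  by_cases huQ : reesChartBase (I := I) a ha a ∈ Q
  · -- ON the exceptional divisor: deform from `A_Q/(u) ≅ (A/(u))_{Q/(u)}`
    have hker : RingHom.ker (Ideal.Quotient.mk (Ideal.span {reesChartBase (I := I) a ha a})) ≤ Q := by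
      rw [Ideal.mk_ker, Ideal.span_singleton_le_iff_mem]
      exact huQ
    obtain ⟨hQ'max, hcomap⟩ := isMaximal_map_and_comap_map_of_surjective
      (Ideal.Quotient.mk (Ideal.span {reesChartBase (I := I) a ha a})) Ideal.Quotient.mk_surjective Q hker
    haveI := hQ'max
    obtain ⟨e⟩ := QuotLocalizationIso.stub_quotLocalizationIso
      (HomogeneousLocalization.Away (reesGrading I) (reesT a ha)) (reesChartBase (I := I) a ha a) Q
      (Q.map (Ideal.Quotient.mk (Ideal.span {reesChartBase (I := I) a ha a}))) hcomap
    have hquot := DegreeZeroDescent.inlineClause_of_ringEquiv p e.symm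
      (hexc (Q.map (Ideal.Quotient.mk (Ideal.span {reesChartBase (I := I) a ha a}))))
    exact OnExceptionalDeform.stub_onExceptionalDeform p
      (HomogeneousLocalization.Away (reesGrading I) (reesT a ha)) (reesChartBase (I := I) a ha a) hu0 Q
      huQ hquot
  · -- OFF the exceptional divisor: `A_Q ≅ R_P`, `P = Q ∩ R ∌ a`
    obtain ⟨e⟩ := nonempty_ringEquiv_offExceptional a ha Q huQ
    have haP : a ∉ Ideal.comap (reesChartBase (I := I) a ha) Q := by
      intro h
      rw [Ideal.mem_comap] at h
      exact huQ h
    obtain ⟨-, hP⟩ := hoff (Ideal.comap (reesChartBase (I := I) a ha) Q) haP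
    exact ⟨inferInstance, DegreeZeroDescent.inlineClause_of_ringEquiv p e.symm hP⟩

/-- **E6 THE BLOW-UP GLUE** (registered stub `stub_blowupFiModel` of crux stmt-ResolutionOfSingularities-15315,
line `Sketch`): `R` a Noetherian domain of characteristic `p`, `I = (x₁,…,x_r) ≠ 0`. If `R_P` satisfies the
full stalk clause at every prime `P ⊉ I`, and for every non-zero generator `xᵢ` the exceptional-divisor chart
`A_{xᵢ} ⧸ (xᵢ/1)` (`A_{xᵢ} = (R[It])_{(xᵢt)}`) satisfies the Cohen–Macaulay + Frobenius-closed clause at each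
of its maximal ideals, then `Spec R` admits the crux's model: `X' = Bl_I(Spec R)` (`affineBlowup I`, proper,
birational), whose stalks are the localizations of the chart rings (`StalkChartIso.stub_stalkChartIso`) and
satisfy the clause by `chart_fiClause`. [folklore] -/
theorem stub_blowupFiModel : ∀ (p : ℕ) [Fact p.Prime] (R : Type) [CommRing R] [IsDomain R] [IsNoetherianRing R]
    [CharP R p] (r : ℕ) (x : Fin r → R), Ideal.span (Set.range x) ≠ ⊥ →
    (∀ (P : Ideal R) [P.IsPrime], ¬ Ideal.span (Set.range x) ≤ P →
      IsDomain (Localization.AtPrime P) ∧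
      ∀ d : ℕ, ringKrullDim (Localization.AtPrime P) = d → ∀ s : Fin d → Localization.AtPrime P,
        (Ideal.span (Set.range s)).radical.IsMaximal →
          RingTheory.Sequence.IsWeaklyRegular (Localization.AtPrime P) (List.ofFn s) ∧
          ∀ y : Localization.AtPrime P, (∃ e : ℕ, y ^ p ^ e ∈ Ideal.span
            ((fun z : Localization.AtPrime P => z ^ p ^ e) ''
              (Ideal.span (Set.range s) : Set (Localization.AtPrime P)))) → y ∈ Ideal.span (Set.range s)) →
    (∀ (i : Fin r), x i ≠ 0 →
      ∀ (Q : Ideal (HomogeneousLocalization.Away (reesGrading (Ideal.span (Set.range x)))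
          (reesT (x i) (Ideal.subset_span (Set.mem_range_self i))) ⧸
          Ideal.span {reesChartBase (x i) (Ideal.subset_span (Set.mem_range_self i)) (x i)})) [Q.IsMaximal],
      ∀ d : ℕ, ringKrullDim (Localization.AtPrime Q) = d → ∀ s : Fin d → Localization.AtPrime Q,
        (Ideal.span (Set.range s)).radical.IsMaximal →
          RingTheory.Sequence.IsWeaklyRegular (Localization.AtPrime Q) (List.ofFn s) ∧
          ∀ y : Localization.AtPrime Q, (∃ e : ℕ, y ^ p ^ e ∈ Ideal.span
            ((fun z : Localization.AtPrime Q => z ^ p ^ e) ''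
              (Ideal.span (Set.range s) : Set (Localization.AtPrime Q)))) → y ∈ Ideal.span (Set.range s)) →
    ∃ (X' : Scheme.{0}) (π : X' ⟶ Spec (.of R)), IsProper π ∧
      Literature.AlgebraicGeometry.Resolution.IsBirational π ∧
      ∀ y : X', IsDomain (X'.presheaf.stalk y) ∧ ∀ d : ℕ, ringKrullDim (X'.presheaf.stalk y) = d →
        ∀ s : Fin d → X'.presheaf.stalk y, (Ideal.span (Set.range s)).radical.IsMaximal →
          RingTheory.Sequence.IsWeaklyRegular (X'.presheaf.stalk y) (List.ofFn s) ∧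
          ∀ z : X'.presheaf.stalk y, (∃ e : ℕ, z ^ p ^ e ∈
              Ideal.span ((fun w : X'.presheaf.stalk y => w ^ p ^ e) ''
                (Ideal.span (Set.range s) : Set (X'.presheaf.stalk y)))) →
            z ∈ Ideal.span (Set.range s) := by
  intro p _ R _ _ _ _ r x hI hoff hexc
  refine ⟨affineBlowup (Ideal.span (Set.range x)), affineBlowup.π (Ideal.span (Set.range x)), inferInstance,
    affineBlowup.isBirational hI, fun y => ?_⟩
  obtain ⟨i, q, hxi, ⟨e⟩⟩ := StalkChartIso.stub_stalkChartIso R r x y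
  have hoff' : ∀ (P : Ideal R) [P.IsPrime], x i ∉ P →
      IsDomain (Localization.AtPrime P) ∧
      ∀ d : ℕ, ringKrullDim (Localization.AtPrime P) = d → ∀ s : Fin d → Localization.AtPrime P,
        (Ideal.span (Set.range s)).radical.IsMaximal →
          RingTheory.Sequence.IsWeaklyRegular (Localization.AtPrime P) (List.ofFn s) ∧
          ∀ y : Localization.AtPrime P, (∃ e : ℕ, y ^ p ^ e ∈ Ideal.span
            ((fun z : Localization.AtPrime P => z ^ p ^ e) ''
              (Ideal.span (Set.range s) : Set (Localization.AtPrime P)))) → y ∈ Ideal.span (Set.range s) :=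
    fun P _ hxP => hoff P fun hle => hxP (hle (Ideal.subset_span (Set.mem_range_self i)))
  obtain ⟨hdom, hq⟩ := chart_fiClause p (x i) (Ideal.subset_span (Set.mem_range_self i)) hxi hoff' (hexc i hxi)
    q.asIdeal
  haveI := hdom
  exact ⟨MulEquiv.isDomain (Localization.AtPrime q.asIdeal) e.toMulEquiv,
    DegreeZeroDescent.inlineClause_of_ringEquiv p e.symm hq⟩

/-! ## The basic form: clause certified directly at the exceptional points of the charts

For ORDINARY blow-ups of points on hypersurfaces the exceptional divisor `Proj(gr_I R)` is usually NOT
reduced (tangent cone `z² = 0` of `E₈⁰`), so the deformation hypothesis of `stub_blowupFiModel` fails there;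
what one certifies instead (Fedder's criterion E2 on an explicit presentation of the chart, or the Jacobian
criterion) is the clause at the local rings `A_Q` of the blown-up chart itself at the maximal ideals `Q` on
the exceptional divisor. The two theorems below are that basic form (E6′); `stub_blowupFiModel` is
E6′ + E1. -/

/-- **Chart form, basic variant (E6′)**: the chart ring `A = (R[It])_{(at)}` (`a ∈ I` non-zero, `R` a
Noetherian domain of characteristic `p`) satisfies the full stalk clause at every prime as soon as `R_P`
does at the primes `P ∌ a` and `A_Q` satisfies the Cohen–Macaulay + Frobenius-closed clause at every
MAXIMAL ideal `Q ∋ a/1` (the closed points of the chart on the exceptional divisor). [folklore] -/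
theorem chart_fiClause_of_maximal {R : Type} [CommRing R] [IsDomain R] [IsNoetherianRing R] [CharP R p]
    {I : Ideal R} (a : R) (ha : a ∈ I) (ha0 : a ≠ 0)
    (hoff : ∀ (P : Ideal R) [P.IsPrime], a ∉ P →
      IsDomain (Localization.AtPrime P) ∧
      ∀ d : ℕ, ringKrullDim (Localization.AtPrime P) = d → ∀ s : Fin d → Localization.AtPrime P,
        (Ideal.span (Set.range s)).radical.IsMaximal →
          RingTheory.Sequence.IsWeaklyRegular (Localization.AtPrime P) (List.ofFn s) ∧
          ∀ y : Localization.AtPrime P, (∃ e : ℕ, y ^ p ^ e ∈ Ideal.span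
            ((fun z : Localization.AtPrime P => z ^ p ^ e) ''
              (Ideal.span (Set.range s) : Set (Localization.AtPrime P)))) → y ∈ Ideal.span (Set.range s))
    (hon : ∀ (Q : Ideal (HomogeneousLocalization.Away (reesGrading I) (reesT a ha))) [Q.IsMaximal],
      reesChartBase (I := I) a ha a ∈ Q →
      ∀ d : ℕ, ringKrullDim (Localization.AtPrime Q) = d → ∀ s : Fin d → Localization.AtPrime Q,
        (Ideal.span (Set.range s)).radical.IsMaximal →
          RingTheory.Sequence.IsWeaklyRegular (Localization.AtPrime Q) (List.ofFn s) ∧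
          ∀ y : Localization.AtPrime Q, (∃ e : ℕ, y ^ p ^ e ∈ Ideal.span
            ((fun z : Localization.AtPrime Q => z ^ p ^ e) ''
              (Ideal.span (Set.range s) : Set (Localization.AtPrime Q)))) → y ∈ Ideal.span (Set.range s))
    (q : Ideal (HomogeneousLocalization.Away (reesGrading I) (reesT a ha))) [q.IsPrime] :
    IsDomain (Localization.AtPrime q) ∧
      ∀ d : ℕ, ringKrullDim (Localization.AtPrime q) = d → ∀ s : Fin d → Localization.AtPrime q,
        (Ideal.span (Set.range s)).radical.IsMaximal →
          RingTheory.Sequence.IsWeaklyRegular (Localization.AtPrime q) (List.ofFn s) ∧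
          ∀ y : Localization.AtPrime q, (∃ e : ℕ, y ^ p ^ e ∈ Ideal.span
            ((fun z : Localization.AtPrime q => z ^ p ^ e) ''
              (Ideal.span (Set.range s) : Set (Localization.AtPrime q)))) → y ∈ Ideal.span (Set.range s) := by
  obtain ⟨hnoeth, hdom, hchar⟩ := ReesChartRing.stub_reesChartRing p R I a ha ha0
  refine ClauseOfMaximal.stub_clauseOfMaximal p
    (HomogeneousLocalization.Away (reesGrading I) (reesT a ha)) ?_ q
  intro Q hQmax
  by_cases huQ : reesChartBase (I := I) a ha a ∈ Q
  · exact ⟨inferInstance, hon Q huQ⟩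
  · obtain ⟨e⟩ := nonempty_ringEquiv_offExceptional a ha Q huQ
    have haP : a ∉ Ideal.comap (reesChartBase (I := I) a ha) Q := by
      intro h
      rw [Ideal.mem_comap] at h
      exact huQ h
    obtain ⟨-, hP⟩ := hoff (Ideal.comap (reesChartBase (I := I) a ha) Q) haP
    exact ⟨inferInstance, DegreeZeroDescent.inlineClause_of_ringEquiv p e.symm hP⟩

/-- **E6′ THE BLOW-UP GLUE, basic form**: `R` a Noetherian domain of characteristic `p`,
`I = (x₁,…,x_r) ≠ 0`. If `R_P` satisfies the full stalk clause at every prime `P ⊉ I`, and for every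
non-zero generator `xᵢ` the chart ring `A_{xᵢ} = (R[It])_{(xᵢt)}` satisfies the Cohen–Macaulay +
Frobenius-closed clause at each MAXIMAL ideal containing `xᵢ/1` (its closed points on the exceptional
divisor — certified in practice by Fedder's criterion on a presentation of the chart, or by the Jacobian
criterion), then `Spec R` admits the crux's model `X' = Bl_I(Spec R) = affineBlowup I` (proper, birational,
every stalk a domain with all systems of parameters weakly regular and all parameter ideals Frobenius
closed). [folklore] -/
theorem blowupFiModel_of_maximal {R : Type} [CommRing R] [IsDomain R] [IsNoetherianRing R] [CharP R p]
    {r : ℕ} (x : Fin r → R) (hI : Ideal.span (Set.range x) ≠ ⊥)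
    (hoff : ∀ (P : Ideal R) [P.IsPrime], ¬ Ideal.span (Set.range x) ≤ P →
      IsDomain (Localization.AtPrime P) ∧
      ∀ d : ℕ, ringKrullDim (Localization.AtPrime P) = d → ∀ s : Fin d → Localization.AtPrime P,
        (Ideal.span (Set.range s)).radical.IsMaximal →
          RingTheory.Sequence.IsWeaklyRegular (Localization.AtPrime P) (List.ofFn s) ∧
          ∀ y : Localization.AtPrime P, (∃ e : ℕ, y ^ p ^ e ∈ Ideal.span
            ((fun z : Localization.AtPrime P => z ^ p ^ e) ''
              (Ideal.span (Set.range s) : Set (Localization.AtPrime P)))) → y ∈ Ideal.span (Set.range s))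
    (hon : ∀ (i : Fin r), x i ≠ 0 →
      ∀ (Q : Ideal (HomogeneousLocalization.Away (reesGrading (Ideal.span (Set.range x)))
          (reesT (x i) (Ideal.subset_span (Set.mem_range_self i))))) [Q.IsMaximal],
      reesChartBase (I := Ideal.span (Set.range x)) (x i) (Ideal.subset_span (Set.mem_range_self i)) (x i) ∈ Q →
      ∀ d : ℕ, ringKrullDim (Localization.AtPrime Q) = d → ∀ s : Fin d → Localization.AtPrime Q,
        (Ideal.span (Set.range s)).radical.IsMaximal →
          RingTheory.Sequence.IsWeaklyRegular (Localization.AtPrime Q) (List.ofFn s) ∧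
          ∀ y : Localization.AtPrime Q, (∃ e : ℕ, y ^ p ^ e ∈ Ideal.span
            ((fun z : Localization.AtPrime Q => z ^ p ^ e) ''
              (Ideal.span (Set.range s) : Set (Localization.AtPrime Q)))) → y ∈ Ideal.span (Set.range s)) :
    ∃ (X' : Scheme.{0}) (π : X' ⟶ Spec (.of R)), IsProper π ∧
      Literature.AlgebraicGeometry.Resolution.IsBirational π ∧
      ∀ y : X', IsDomain (X'.presheaf.stalk y) ∧ ∀ d : ℕ, ringKrullDim (X'.presheaf.stalk y) = d →
        ∀ s : Fin d → X'.presheaf.stalk y, (Ideal.span (Set.range s)).radical.IsMaximal →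
          RingTheory.Sequence.IsWeaklyRegular (X'.presheaf.stalk y) (List.ofFn s) ∧
          ∀ z : X'.presheaf.stalk y, (∃ e : ℕ, z ^ p ^ e ∈
              Ideal.span ((fun w : X'.presheaf.stalk y => w ^ p ^ e) ''
                (Ideal.span (Set.range s) : Set (X'.presheaf.stalk y)))) →
            z ∈ Ideal.span (Set.range s) := by
  refine ⟨affineBlowup (Ideal.span (Set.range x)), affineBlowup.π (Ideal.span (Set.range x)), inferInstance,
    affineBlowup.isBirational hI, fun y => ?_⟩
  obtain ⟨i, q, hxi, ⟨e⟩⟩ := StalkChartIso.stub_stalkChartIso R r x y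
  have hoff' : ∀ (P : Ideal R) [P.IsPrime], x i ∉ P →
      IsDomain (Localization.AtPrime P) ∧
      ∀ d : ℕ, ringKrullDim (Localization.AtPrime P) = d → ∀ s : Fin d → Localization.AtPrime P,
        (Ideal.span (Set.range s)).radical.IsMaximal →
          RingTheory.Sequence.IsWeaklyRegular (Localization.AtPrime P) (List.ofFn s) ∧
          ∀ y : Localization.AtPrime P, (∃ e : ℕ, y ^ p ^ e ∈ Ideal.span
            ((fun z : Localization.AtPrime P => z ^ p ^ e) ''
              (Ideal.span (Set.range s) : Set (Localization.AtPrime P)))) → y ∈ Ideal.span (Set.range s) :=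
    fun P _ hxP => hoff P fun hle => hxP (hle (Ideal.subset_span (Set.mem_range_self i)))
  obtain ⟨hdom, hq⟩ := chart_fiClause_of_maximal p (x i) (Ideal.subset_span (Set.mem_range_self i)) hxi hoff'
    (hon i hxi) q.asIdeal
  haveI := hdom
  exact ⟨MulEquiv.isDomain (Localization.AtPrime q.asIdeal) e.toMulEquiv,
    DegreeZeroDescent.inlineClause_of_ringEquiv p e.symm hq⟩

end Summit.ResolutionOfSingularities.ResolutionOfSingularities.Theorems.FInjectiveMacaulayfication.BlowupFiModel

end
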